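/-
Copyright: lit-balaban Phase-2 proof seat p02 (gen 11).  Statement-level skeleton of a published paper; no proof claims beyond what
the kernel checks below.
-/
import Literature.MathematicalPhysics.QuantumFieldTheory.BalabanImbrieJaffe1984to88.BIJ88Assoc575Zd
import Literature.MathematicalPhysics.QuantumFieldTheory.Balaban1983to89.B3TorusRadialSums

/-!
# `BalabanImbrieJaffe1984to88.BIJ88Assoc575Torus` — T. Bałaban, J. Imbrie, A. Jaffe, *Effective action and cluster properties of the
abelian Higgs model*, Commun. Math. Phys. **114** (1988) 257–315 [BalabanImbrieJaffe1988]: Sect. 5.7 p. 289, the ASSOCIATION MAP of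
**(5.7.5)** realized ON THE TORUS OF RECORD `Balaban1983to89.Site P j = T^{(j)}` of the series (periodic geometry) — *"To each b ∈ T_η and each
collection of bonds b₁, …, b_m ∈ T^{(k)} we associate in some arbitrary manner a set X (a connected union of r(e_k)-cubes containing
them)"* — together with the cube geometry (containment, connectedness, tightness) that the one-line proof of **(5.7.6)** p. 290 uses.

statement-level skeleton of published theorems with citation tags; proofs where landed; nothing here is a claim about the Yang–Mills mass gap

PDF held: `paper:balaban1988-cmp114-bij-abelian-higgs-effective-action` (journal page = PDF page + 256); p. 289 [PDF 33] ll. 35–41 and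
p. 290 [PDF 34] ll. 2–4 read this session on the text layer (`lit read`), p. 303 [PDF 47] l. 21 (*"We associate to any collection of
localization cubes a smallest connected union of cubes containing them"*).

CITATION HEADER (lean-in-tree rule).  Part of the lit-balaban TYPED SKELETON (HOME `run/shared/lean/pub/lit-balaban/`), Phase 2, seat
p02 (gen 11, unit `lit-balaban-p02`); file 1/2 for row **C2.Eq5.7.5-5.7.6** of `HOME/lit-balaban-r16/ROWS-C2-part2.md` (owner r16;
leaf `BIJ88Sect5StatementsPart2.Ineq576` typed p240155; the localized powers `w_{b,m}(X)` = r16's `BIJ88Sect5StatementsPart4.wbm`,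
p245624, association map abstract; (5.7.6) proved for the `ℤ^d` association by p36, `BIJ88Assoc575Zd` + `BIJ88Ineq576Proof`,
p247333/p247565 — the MODEL OF RECORD on `ℤ^d`, imported here and not restated).  THIS FILE replaces `ℤ^d` by the finite torus
`T^{(j)} = (ZMod (2L^{m+K−j}))^d` of `Balaban1983to89.Setup` (the carrier of every torus file of C2), on which the paper's `T_η`,
`T^{(k)}` actually live: the `r(e_k)`-cubes of side `ℓ` PAVE THE TORUS PERIODICALLY — `⌈N/ℓ⌉` cubes per direction (`nCube`), the cube
of a site being `⌊x_μ/ℓ⌋` coordinatewise (`cubeT`; when `ℓ ∤ N` the last cube of each direction is truncated at the seam — a model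
choice, the print fixes no paving), the cube indices form the discrete torus `(ZMod ⌈N/ℓ⌉)^d` (`CubeTor`), and a staircase between
two cubes runs along the SHORTER ARC in every coordinate (`toward`, `segT`, `stairT`; step count = p20's circular distance
`B3TorusRadialSums.cdist`).  WHAT IS REPRODUCED, and how (every item PROVED; distances = the `ℓ^∞` torus distance of record
`LatticeFieldCalculus.supDist`):
* §1 the torus staircase between two cube indices (`cornerT`, `toward`, `segT`, `stairT`): contains both ends, `card ≤ Σ_μ cdist + d`
  (`card_stairT_le`), and is a chain of touching cubes for the torus touching relation `touchT` (`cdist ≤ 1` in every coordinate):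
  `reachable_of_mem_stairT`.
* §2 the cubes of the torus: `nCube N ℓ = (N − 1)/ℓ + 1 = ⌈N/ℓ⌉`, `cubeT ℓ x = (⌊x_μ/ℓ⌋)_μ`, and THE CUBE ARITHMETIC ACROSS THE SEAM
  `ℓ·val(cube y − cube x) ≤ val(y − x) + 2ℓ` (`mul_val_cubeDiff_le`), hence `ℓ·cdist(cube x − cube y) ≤ cdist(x − y) + 2ℓ`
  (`mul_cdist_cubeT_le`) and `ℓ·Σ_μ cdist(cube x − cube y) ≤ d(supDist x y + 2ℓ)` (`mul_l1T_cubeT_le`).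
* §3 **the association** `assocT pos ℓ x₀ m t = cube(x₀) ∪ ⋃_l stairT(cube(x₀), cube(b_l))` (`x₀` = the site of `T^{(j)}` locating
  `b` — `b` itself when `b ∈ T^{(k)}`, its `k`-block when `b ∈ T_η`): it CONTAINS the cubes of `x₀, b₁, …, b_m` (`cube_mem_assocT`,
  `cube_tuple_mem_assocT`), it is CONNECTED (`assocT_connected`: the torus touching graph induced on it is connected), and it is
  TIGHT: `ℓ(|X| − 1) ≤ d·Σ_l supDist(x₀, b_l) + 3d·m·ℓ` (`tight_assocT`).
READING NOTE (as in p36's files, recorded, not adjudicated): (5.7.6) holds for every tight association, not for a literally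
arbitrary one; p. 303 l. 21 later takes *"a smallest connected union of cubes"*, which is tight.  NOT here: the kernel `w₅`, the
field `A′`, the lattice sum and (5.7.6) itself (file 2/2 `BIJ88Ineq576Torus`).  No new `Prop` facts; definitions with bodies only
(`l1T`, `cornerT`, `toward`, `segT`, `stairT`, `touchT`, `nCube`, `CubeTor`, `cubeT`, `assocT`); 0 `sorry`; axioms standard.
-/

namespace Literature.MathematicalPhysics.QuantumFieldTheory.BalabanImbrieJaffe1984to88.BIJ88Assoc575Torus

open Finset
open Literature.MathematicalPhysics.QuantumFieldTheory.Balaban1983to89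
open Balaban1983to89.LatticeFieldCalculus (supDist)
open Balaban1983to89.B3TorusRadialSums (cdist cdist_neg cdist_le_val cdist_le_supDist cdist_eq_zero_iff supDist_comm)

noncomputable section

/-! ## §1 The shorter arc and the staircase on a discrete torus `(ZMod n)^d` -/

section Torus

variable {dd n : ℕ}

/-- the number of unit steps of a torus staircase from `i` to `j`: `Σ_μ cdist(j_μ − i_μ)` (shorter arc in every coordinate).
[cite: BalabanImbrieJaffe1988, (5.7.5) p.289] -/
def l1T (i j : Fin dd → ZMod n) : ℕ := ∑ μ, cdist (j μ - i μ)

/-- the `μ`-th CORNER of the staircase from `i` to `j`: coordinates `< μ` already moved to `j`, the others still at `i`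
(`cornerT 0 = i`, `cornerT d = j`). [cite: BalabanImbrieJaffe1988, (5.7.5) p.289] -/
def cornerT (i j : Fin dd → ZMod n) (μ : ℕ) : Fin dd → ZMod n := fun ν => if (ν : ℕ) < μ then j ν else i ν

/-- `cornerT 0 = i`. [cite: BalabanImbrieJaffe1988, (5.7.5) p.289] -/
theorem cornerT_zero (i j : Fin dd → ZMod n) : cornerT i j 0 = i := by
  funext ν; simp [cornerT]

/-- `cornerT d = j`. [cite: BalabanImbrieJaffe1988, (5.7.5) p.289] -/
theorem cornerT_dd (i j : Fin dd → ZMod n) : cornerT i j dd = j := by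
  funext ν; simp [cornerT, ν.isLt]

/-- the point reached after `s` unit steps from `a` toward `b` ALONG THE SHORTER ARC of the cycle `ZMod n` (forward if the
forward arc `val(b − a)` is not longer than the backward arc `val(a − b)`, backward otherwise). [cite: BalabanImbrieJaffe1988, (5.7.5) p.289] -/
def toward (a b : ZMod n) (s : ℕ) : ZMod n := if (b - a).val ≤ (a - b).val then a + s else a - s

/-- `toward a b 0 = a`. [cite: BalabanImbrieJaffe1988, (5.7.5) p.289] -/
theorem toward_zero (a b : ZMod n) : toward a b 0 = a := by
  unfold toward; split_ifs <;> simp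

/-- the circular distance of a difference is the length of the shorter arc: `cdist(b − a) = min(val(b − a), val(a − b))`.
[cite: BalabanImbrieJaffe1988, (5.7.5) p.289] -/
theorem cdist_sub_eq (a b : ZMod n) : cdist (b - a) = min (b - a).val (a - b).val := by
  rw [cdist, neg_sub]

/-- after `cdist(b − a)` steps the shorter arc reaches `b`. [cite: BalabanImbrieJaffe1988, (5.7.5) p.289] -/
theorem toward_cdist [NeZero n] (a b : ZMod n) : toward a b (cdist (b - a)) = b := by
  rw [cdist_sub_eq]
  unfold toward
  split_ifs with h
  · rw [min_eq_left h, ZMod.natCast_zmod_val]; abel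
  · rw [min_eq_right (le_of_not_ge h), ZMod.natCast_zmod_val]; abel

/-- consecutive points of the arc differ by `±1`. [cite: BalabanImbrieJaffe1988, (5.7.5) p.289] -/
theorem toward_succ_sub (a b : ZMod n) (s : ℕ) :
    toward a b (s + 1) - toward a b s = 1 ∨ toward a b (s + 1) - toward a b s = -1 := by
  unfold toward
  split_ifs
  · left; push_cast; ring
  · right; push_cast; ring

/-- `cdist 1 ≤ 1`. [cite: BalabanImbrieJaffe1988, (5.7.5) p.289] -/
theorem cdist_one_le : cdist (1 : ZMod n) ≤ 1 :=
  (cdist_le_val _).trans (by rw [ZMod.val_one_eq_one_mod]; exact Nat.mod_le 1 n)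

/-- consecutive points of the arc are at circular distance `≤ 1`. [cite: BalabanImbrieJaffe1988, (5.7.5) p.289] -/
theorem cdist_toward_succ_le (a b : ZMod n) (s : ℕ) : cdist (toward a b s - toward a b (s + 1)) ≤ 1 := by
  rw [← cdist_neg, neg_sub]
  rcases toward_succ_sub a b s with h | h
  · rw [h]; exact cdist_one_le
  · rw [h, cdist_neg]; exact cdist_one_le

/-- the `μ`-th SEGMENT of the staircase: the corner `cornerT μ` with its `μ`-th coordinate running along the shorter arc from `i_μ`
to `j_μ`. [cite: BalabanImbrieJaffe1988, (5.7.5) p.289] -/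
def segT (i j : Fin dd → ZMod n) (μ : Fin dd) : Finset (Fin dd → ZMod n) :=
  (Finset.range (cdist (j μ - i μ) + 1)).image fun s => Function.update (cornerT i j μ) μ (toward (i μ) (j μ) s)

/-- the STAIRCASE from `i` to `j` = the union of its `d` segments. [cite: BalabanImbrieJaffe1988, (5.7.5) p.289] -/
def stairT (i j : Fin dd → ZMod n) : Finset (Fin dd → ZMod n) := Finset.univ.biUnion fun μ => segT i j μ

/-- membership in a segment. [cite: BalabanImbrieJaffe1988, (5.7.5) p.289] -/
theorem mem_segT {i j : Fin dd → ZMod n} {μ : Fin dd} {p : Fin dd → ZMod n} :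
    p ∈ segT i j μ ↔ ∃ s, s < cdist (j μ - i μ) + 1 ∧ Function.update (cornerT i j μ) μ (toward (i μ) (j μ) s) = p := by
  unfold segT
  rw [Finset.mem_image]
  simp only [Finset.mem_range]

/-- the corner `cornerT μ` is the `s = 0` point of the `μ`-th segment. [cite: BalabanImbrieJaffe1988, (5.7.5) p.289] -/
theorem update_cornerT_self (i j : Fin dd → ZMod n) (μ : Fin dd) :
    Function.update (cornerT i j μ) μ (i μ) = cornerT i j μ := by
  funext ν
  by_cases hν : ν = μ
  · subst hν; simp [cornerT]
  · rw [Function.update_of_ne hν]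

/-- the next corner `cornerT (μ+1)` is the endpoint of the `μ`-th segment. [cite: BalabanImbrieJaffe1988, (5.7.5) p.289] -/
theorem update_cornerT_next (i j : Fin dd → ZMod n) (μ : Fin dd) :
    Function.update (cornerT i j μ) μ (j μ) = cornerT i j (μ + 1) := by
  funext ν
  by_cases hν : ν = μ
  · subst hν; simp [cornerT]
  · rw [Function.update_of_ne hν]
    have hν' : (ν : ℕ) ≠ μ := fun h => hν (Fin.ext h)
    unfold cornerT
    split_ifs <;> first | rfl | omega

/-- `cornerT μ ∈ segT μ`. [cite: BalabanImbrieJaffe1988, (5.7.5) p.289] -/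
theorem corner_mem_segT (i j : Fin dd → ZMod n) (μ : Fin dd) : cornerT i j μ ∈ segT i j μ :=
  mem_segT.mpr ⟨0, Nat.succ_pos _, by rw [toward_zero, update_cornerT_self]⟩

/-- `cornerT (μ+1) ∈ segT μ`. [cite: BalabanImbrieJaffe1988, (5.7.5) p.289] -/
theorem corner_next_mem_segT [NeZero n] (i j : Fin dd → ZMod n) (μ : Fin dd) : cornerT i j (μ + 1) ∈ segT i j μ :=
  mem_segT.mpr ⟨cdist (j μ - i μ), Nat.lt_succ_self _, by rw [toward_cdist, update_cornerT_next]⟩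

/-- the staircase contains its start `i` (for `d ≥ 1`). [cite: BalabanImbrieJaffe1988, (5.7.5) p.289] -/
theorem left_mem_stairT (hd : 0 < dd) (i j : Fin dd → ZMod n) : i ∈ stairT i j := by
  unfold stairT
  rw [Finset.mem_biUnion]
  refine ⟨⟨0, hd⟩, Finset.mem_univ _, ?_⟩
  have h := corner_mem_segT i j ⟨0, hd⟩
  rwa [show ((⟨0, hd⟩ : Fin dd) : ℕ) = 0 from rfl, cornerT_zero] at h

/-- the staircase contains its end `j` (for `d ≥ 1`). [cite: BalabanImbrieJaffe1988, (5.7.5) p.289] -/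
theorem right_mem_stairT [NeZero n] (hd : 0 < dd) (i j : Fin dd → ZMod n) : j ∈ stairT i j := by
  unfold stairT
  rw [Finset.mem_biUnion]
  refine ⟨⟨dd - 1, by omega⟩, Finset.mem_univ _, ?_⟩
  have h := corner_next_mem_segT i j ⟨dd - 1, by omega⟩
  rwa [show ((⟨dd - 1, by omega⟩ : Fin dd) : ℕ) + 1 = dd by simp; omega, cornerT_dd] at h

/-- a segment has at most `cdist(j_μ − i_μ) + 1` cubes. [cite: BalabanImbrieJaffe1988, (5.7.5) p.289] -/
theorem card_segT_le (i j : Fin dd → ZMod n) (μ : Fin dd) : (segT i j μ).card ≤ cdist (j μ - i μ) + 1 := by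
  unfold segT
  refine Finset.card_image_le.trans ?_
  rw [Finset.card_range]

/-- **CARD OF THE TORUS STAIRCASE**: `|stairT(i,j)| ≤ Σ_μ cdist(j_μ − i_μ) + d`. [cite: BalabanImbrieJaffe1988, (5.7.5) p.289] -/
theorem card_stairT_le (i j : Fin dd → ZMod n) : (stairT i j).card ≤ l1T i j + dd := by
  unfold stairT l1T
  refine Finset.card_biUnion_le.trans ?_
  calc ∑ μ, (segT i j μ).card ≤ ∑ μ, (cdist (j μ - i μ) + 1) := Finset.sum_le_sum fun μ _ => card_segT_le i j μ
    _ = (∑ μ, cdist (j μ - i μ)) + dd := by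
        rw [Finset.sum_add_distrib, Finset.sum_const, Finset.card_univ, Fintype.card_fin, smul_eq_mul, mul_one]

/-! ### The torus staircase is a chain of touching cubes -/

/-- the TOUCHING relation of cubes of the cube torus: every coordinate at circular distance `≤ 1` (the periodic analogue of
`B4RandomWalk213.cubeAdj id`, `|j_μ − j′_μ| ≤ 1`). [cite: BalabanImbrieJaffe1988, (5.7.5) p.289] -/
def touchT (p q : Fin dd → ZMod n) : Prop := ∀ μ, cdist (p μ - q μ) ≤ 1

/-- `touchT` is symmetric. [cite: BalabanImbrieJaffe1988, (5.7.5) p.289] -/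
theorem touchT_symm {p q : Fin dd → ZMod n} (h : touchT p q) : touchT q p := fun μ => by
  rw [← cdist_neg, neg_sub]; exact h μ

/-- two points of the cube torus differing only in one coordinate, by circular distance `≤ 1`, touch.
[cite: BalabanImbrieJaffe1988, (5.7.5) p.289] -/
theorem touchT_update (c : Fin dd → ZMod n) (μ : Fin dd) {s s' : ZMod n} (h : cdist (s - s') ≤ 1) :
    touchT (Function.update c μ s) (Function.update c μ s') := by
  intro ν
  by_cases hν : ν = μ
  · subst hν; simpa using h
  · simp only [Function.update_of_ne hν, sub_self]
    rw [(cdist_eq_zero_iff (0 : ZMod n)).mpr rfl]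
    exact Nat.zero_le _

/-- the touching graph induced on a cube set `X`: equal or touching cubes of `X` are joined (reflexive–adjacent step).
[cite: BalabanImbrieJaffe1988, (5.7.5) p.289] -/
theorem reachable_of_touchT {X : Finset (Fin dd → ZMod n)} {p q : Fin dd → ZMod n} (hp : p ∈ (↑X : Set (Fin dd → ZMod n)))
    (hq : q ∈ (↑X : Set (Fin dd → ZMod n))) (h : p = q ∨ touchT p q) :
    ((SimpleGraph.fromRel (touchT (dd := dd) (n := n))).induce (↑X : Set (Fin dd → ZMod n))).Reachable ⟨p, hp⟩ ⟨q, hq⟩ := by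
  by_cases hpq : p = q
  · subst hpq; rfl
  · refine SimpleGraph.Adj.reachable ?_
    rw [SimpleGraph.induce_adj, SimpleGraph.fromRel_adj]
    exact ⟨hpq, Or.inl (h.resolve_left hpq)⟩

/-- along the `μ`-th segment (inside any cube set `X` containing it) every point is reachable from the corner `cornerT μ`
— induction on the number of steps `s` along the shorter arc. [cite: BalabanImbrieJaffe1988, (5.7.5) p.289] -/
theorem reachable_segT (i j : Fin dd → ZMod n) (μ : Fin dd) (X : Finset (Fin dd → ZMod n)) (hX : segT i j μ ⊆ X)
    (h0 : cornerT i j μ ∈ (↑X : Set (Fin dd → ZMod n))) :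
    ∀ s : ℕ, s < cdist (j μ - i μ) + 1 →
      ∀ hs : Function.update (cornerT i j μ) μ (toward (i μ) (j μ) s) ∈ (↑X : Set (Fin dd → ZMod n)),
      ((SimpleGraph.fromRel (touchT (dd := dd) (n := n))).induce (↑X : Set (Fin dd → ZMod n))).Reachable
        ⟨cornerT i j μ, h0⟩ ⟨Function.update (cornerT i j μ) μ (toward (i μ) (j μ) s), hs⟩ := by
  intro s
  induction s with
  | zero =>
      intro _ hs
      exact reachable_of_touchT h0 hs (Or.inl (by rw [toward_zero, update_cornerT_self]))
  | succ s ih =>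
      intro hs1 hs
      have hs' : s < cdist (j μ - i μ) + 1 := by omega
      have hs'X : Function.update (cornerT i j μ) μ (toward (i μ) (j μ) s) ∈ (↑X : Set (Fin dd → ZMod n)) :=
        Finset.mem_coe.mpr (hX (mem_segT.mpr ⟨s, hs', rfl⟩))
      exact (ih hs' hs'X).trans (reachable_of_touchT hs'X hs (Or.inr (touchT_update _ μ (cdist_toward_succ_le _ _ s))))

/-- every corner `cornerT μ` (`μ ≤ d`) is reachable from the start `i` inside any cube set containing the staircase.
[cite: BalabanImbrieJaffe1988, (5.7.5) p.289] -/
theorem reachable_cornerT [NeZero n] (i j : Fin dd → ZMod n) (X : Finset (Fin dd → ZMod n)) (hX : stairT i j ⊆ X)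
    (hi : i ∈ (↑X : Set (Fin dd → ZMod n))) :
    ∀ μ : ℕ, μ ≤ dd → ∀ hμ : cornerT i j μ ∈ (↑X : Set (Fin dd → ZMod n)),
      ((SimpleGraph.fromRel (touchT (dd := dd) (n := n))).induce (↑X : Set (Fin dd → ZMod n))).Reachable
        ⟨i, hi⟩ ⟨cornerT i j μ, hμ⟩ := by
  intro μ
  induction μ with
  | zero =>
      intro _ hμ
      exact reachable_of_touchT hi hμ (Or.inl (cornerT_zero i j).symm)
  | succ μ ih =>
      intro hμd hμ
      have hμ' : μ < dd := by omega
      have hsegX : segT i j ⟨μ, hμ'⟩ ⊆ X := fun p hp =>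
        hX (Finset.mem_biUnion.mpr ⟨⟨μ, hμ'⟩, Finset.mem_univ _, hp⟩)
      have hcX : cornerT i j μ ∈ (↑X : Set (Fin dd → ZMod n)) :=
        Finset.mem_coe.mpr (hsegX (corner_mem_segT i j ⟨μ, hμ'⟩))
      have e : Function.update (cornerT i j μ) ⟨μ, hμ'⟩ (toward (i ⟨μ, hμ'⟩) (j ⟨μ, hμ'⟩) (cdist (j ⟨μ, hμ'⟩ - i ⟨μ, hμ'⟩)))
          = cornerT i j (μ + 1) := by
        rw [toward_cdist]; exact update_cornerT_next i j ⟨μ, hμ'⟩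
      have hnext : Function.update (cornerT i j μ) ⟨μ, hμ'⟩
          (toward (i ⟨μ, hμ'⟩) (j ⟨μ, hμ'⟩) (cdist (j ⟨μ, hμ'⟩ - i ⟨μ, hμ'⟩))) ∈ (↑X : Set (Fin dd → ZMod n)) := by
        rw [e]; exact hμ
      have h := reachable_segT i j ⟨μ, hμ'⟩ X hsegX hcX (cdist (j ⟨μ, hμ'⟩ - i ⟨μ, hμ'⟩)) (Nat.lt_succ_self _) hnext
      have heq : (⟨Function.update (cornerT i j μ) ⟨μ, hμ'⟩
          (toward (i ⟨μ, hμ'⟩) (j ⟨μ, hμ'⟩) (cdist (j ⟨μ, hμ'⟩ - i ⟨μ, hμ'⟩))), hnext⟩ : (↑X : Set (Fin dd → ZMod n)))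
          = ⟨cornerT i j (μ + 1), hμ⟩ := Subtype.ext e
      rw [heq] at h
      exact (ih hμ'.le hcX).trans h

/-- **THE TORUS STAIRCASE IS CONNECTED THROUGH ITS START**: every cube of `stairT(i,j)` is reachable from `i` inside any cube set
containing the staircase. [cite: BalabanImbrieJaffe1988, (5.7.5) p.289] -/
theorem reachable_of_mem_stairT [NeZero n] (i j : Fin dd → ZMod n) (X : Finset (Fin dd → ZMod n)) (hX : stairT i j ⊆ X)
    (hi : i ∈ (↑X : Set (Fin dd → ZMod n))) {p : Fin dd → ZMod n} (hp : p ∈ stairT i j)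
    (hpX : p ∈ (↑X : Set (Fin dd → ZMod n))) :
    ((SimpleGraph.fromRel (touchT (dd := dd) (n := n))).induce (↑X : Set (Fin dd → ZMod n))).Reachable ⟨i, hi⟩ ⟨p, hpX⟩ := by
  obtain ⟨μ, -, hpμ⟩ := Finset.mem_biUnion.mp hp
  obtain ⟨s, hs, rfl⟩ := mem_segT.mp hpμ
  have hsegX : segT i j μ ⊆ X := fun q hq => hX (Finset.mem_biUnion.mpr ⟨μ, Finset.mem_univ _, hq⟩)
  have hcX : cornerT i j μ ∈ (↑X : Set (Fin dd → ZMod n)) := Finset.mem_coe.mpr (hsegX (corner_mem_segT i j μ))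
  exact (reachable_cornerT i j X hX hi μ μ.isLt.le hcX).trans (reachable_segT i j μ X hsegX hcX s hs hpX)

end Torus

/-! ## §2 The `r(e_k)`-cubes paving the torus of record, and the cube arithmetic across the seam -/

section Cubes

/-- the number of cubes of side `ℓ` per direction of a cycle of `N` sites: `⌈N/ℓ⌉ = (N − 1)/ℓ + 1` (the last cube truncated at the
seam when `ℓ ∤ N`; `= 1` in the degenerate case `ℓ = 0`, never used). [cite: BalabanImbrieJaffe1988, (5.7.5) p.289] -/
def nCube (N ℓ : ℕ) : ℕ := (N - 1) / ℓ + 1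

/-- `nCube N ℓ ≠ 0` (it is a successor), so `ZMod (nCube N ℓ)` is a finite cycle. [cite: BalabanImbrieJaffe1988, (5.7.5) p.289] -/
instance nCube_neZero (N ℓ : ℕ) : NeZero (nCube N ℓ) := ⟨Nat.succ_ne_zero _⟩

/-- `nCube − 1 = (N − 1)/ℓ`. [cite: BalabanImbrieJaffe1988, (5.7.5) p.289] -/
theorem nCube_sub_one (N ℓ : ℕ) : nCube N ℓ - 1 = (N - 1) / ℓ :=
  Nat.add_sub_cancel _ 1

/-- the cube index of a residue: `⌊val x/ℓ⌋ < ⌈N/ℓ⌉`. [cite: BalabanImbrieJaffe1988, (5.7.5) p.289] -/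
theorem div_lt_nCube {N : ℕ} [NeZero N] (ℓ : ℕ) (x : ZMod N) : x.val / ℓ < nCube N ℓ := by
  have hx : x.val < N := ZMod.val_lt x
  have h1 : x.val / ℓ ≤ (N - 1) / ℓ := Nat.div_le_div_right (by omega)
  unfold nCube; omega

/-- the cube index as a residue of the cube cycle has value `⌊val x/ℓ⌋`. [cite: BalabanImbrieJaffe1988, (5.7.5) p.289] -/
theorem val_cubeCast {N : ℕ} [NeZero N] (ℓ : ℕ) (x : ZMod N) :
    (((x.val / ℓ : ℕ) : ZMod (nCube N ℓ))).val = x.val / ℓ :=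
  ZMod.val_natCast_of_lt (div_lt_nCube ℓ x)

/-- the `ℓ`-multiples of the cube count stay below the cycle: `ℓ·(⌈N/ℓ⌉ − 1) ≤ N − 1`. [cite: BalabanImbrieJaffe1988, (5.7.5) p.289] -/
theorem mul_nCube_sub_one_le (N ℓ : ℕ) : ℓ * (nCube N ℓ - 1) ≤ N - 1 := by
  rw [nCube_sub_one, mul_comm]
  exact Nat.div_mul_le_self (N - 1) ℓ

/-- **THE CUBE ARITHMETIC ACROSS THE SEAM** (one coordinate): for residues `x, y` of the cycle `ZMod N` with cubes `⌊val/ℓ⌋` in the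
cube cycle `ZMod ⌈N/ℓ⌉`, the FORWARD cube arc is controlled by the forward site arc: `ℓ·val(cube y − cube x) ≤ val(y − x) + 2ℓ`
(inside a period: Euclidean division, `+ℓ`; across the seam: the truncated last cube costs at most one more `ℓ`).
[cite: BalabanImbrieJaffe1988, (5.7.5) p.289] -/
theorem mul_val_cubeDiff_le {N ℓ : ℕ} [NeZero N] (hℓ : 0 < ℓ) (x y : ZMod N) :
    ℓ * (((y.val / ℓ : ℕ) : ZMod (nCube N ℓ)) - ((x.val / ℓ : ℕ) : ZMod (nCube N ℓ))).val ≤ (y - x).val + 2 * ℓ := by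
  obtain ⟨a, ha⟩ : ∃ a, a = x.val / ℓ := ⟨_, rfl⟩
  obtain ⟨c, hc⟩ : ∃ c, c = y.val / ℓ := ⟨_, rfl⟩
  rw [← ha, ← hc]
  have han : a < nCube N ℓ := by rw [ha]; exact div_lt_nCube ℓ x
  have hcn : c < nCube N ℓ := by rw [hc]; exact div_lt_nCube ℓ y
  have hxN : x.val < N := ZMod.val_lt x
  have hyN : y.val < N := ZMod.val_lt y
  -- Euclidean division facts, products as atoms
  have hxa : x.val < ℓ * a + ℓ := by
    have h := Nat.lt_div_mul_add (a := x.val) hℓ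
    rw [mul_comm, ← ha] at h; exact h
  have hcy : ℓ * c ≤ y.val := by
    have h := Nat.div_mul_le_self y.val ℓ
    rw [mul_comm, ← hc] at h; exact h
  have hnN : ℓ * (nCube N ℓ - 1) ≤ N - 1 := mul_nCube_sub_one_le N ℓ
  rcases le_or_gt x.val y.val with hxy | hxy
  · -- inside a period: both arcs forward
    have hac : a ≤ c := by rw [ha, hc]; exact Nat.div_le_div_right hxy
    obtain ⟨e, he⟩ := Nat.exists_eq_add_of_le hac
    -- `c = a + e`: the forward cube arc has `e` steps
    have hen : e < nCube N ℓ := lt_of_le_of_lt (by rw [he]; exact Nat.le_add_left e a) hcn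
    have h1 : (y - x).val = y.val - x.val := ZMod.val_sub hxy
    have h2 : (((c : ℕ) : ZMod (nCube N ℓ)) - ((a : ℕ) : ZMod (nCube N ℓ))).val = e := by
      rw [he, Nat.cast_add, add_sub_cancel_left]
      exact ZMod.val_natCast_of_lt hen
    rw [h1, h2]
    have h3 : ℓ * c = ℓ * a + ℓ * e := by rw [he, mul_add]
    omega
  · -- across the seam: `y` behind `x`
    have hca : c ≤ a := by rw [ha, hc]; exact Nat.div_le_div_right hxy.le
    have hxy' : (x - y).val = x.val - y.val := ZMod.val_sub hxy.le
    have hne : x - y ≠ 0 := by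
      intro h0
      have : (x - y).val = 0 := by rw [h0, ZMod.val_zero]
      omega
    have h1 : (y - x).val = N - (x.val - y.val) := by
      rw [← neg_sub, ZMod.neg_val, if_neg hne, hxy']
    rcases hca.eq_or_lt with hca' | hca'
    · -- same cube
      rw [hca', sub_self, ZMod.val_zero, mul_zero]
      exact Nat.zero_le _
    · obtain ⟨e, he⟩ := Nat.exists_eq_add_of_lt hca'
      -- `a = c + e + 1`
      obtain ⟨f, hf⟩ := Nat.exists_eq_add_of_lt han
      -- `nCube = a + f + 1`: the forward cube arc from cube `a` across the seam to cube `c` has `c + f + 1` steps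
      have hcf : c + f + 1 < nCube N ℓ := by rw [hf, he]; omega
      have hdiff : (((c : ℕ) : ZMod (nCube N ℓ)) - ((a : ℕ) : ZMod (nCube N ℓ))) = ((c + f + 1 : ℕ) : ZMod (nCube N ℓ)) := by
        rw [sub_eq_iff_eq_add, ← Nat.cast_add]
        have : (c + f + 1 + a : ℕ) = c + nCube N ℓ := by rw [hf]; ring
        rw [this, Nat.cast_add, ZMod.natCast_self, add_zero]
      have h2 : (((c : ℕ) : ZMod (nCube N ℓ)) - ((a : ℕ) : ZMod (nCube N ℓ))).val = c + f + 1 := by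
        rw [hdiff]; exact ZMod.val_natCast_of_lt hcf
      rw [h1, h2]
      have h3 : ℓ * (nCube N ℓ - 1) = ℓ * c + ℓ * e + ℓ * f + ℓ := by
        have : nCube N ℓ - 1 = c + e + f + 1 := by rw [hf, he]; omega
        rw [this]; ring
      have h4 : ℓ * a = ℓ * c + ℓ * e + ℓ := by rw [he]; ring
      rw [h3] at hnN
      rw [h4] at hxa
      have h5 : ℓ * (c + f + 1) = ℓ * c + ℓ * f + ℓ := by ring
      rw [h5]
      omega

variable {P : Params} {j : ℕ}

/-- the CUBE TORUS of the `r(e_k)`-cubes of side `ℓ` paving `T^{(j)}`: `(ZMod ⌈N/ℓ⌉)^d`, `N = 2L^{m+K−j}` sites per direction.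
[cite: BalabanImbrieJaffe1988, (5.7.5) p.289] -/
abbrev CubeTor (P : Params) (j ℓ : ℕ) : Type := Fin P.d → ZMod (nCube (P.sitesPerDir j) ℓ)

/-- the cube of a site of `T^{(j)}`: `⌊x_μ/ℓ⌋` coordinatewise, as a point of the cube torus. [cite: BalabanImbrieJaffe1988, (5.7.5) p.289] -/
def cubeT (ℓ : ℕ) (x : Balaban1983to89.Site P j) : CubeTor P j ℓ := fun μ => (((x μ).val / ℓ : ℕ) : ZMod (nCube (P.sitesPerDir j) ℓ))

/-- the value of a cube coordinate. [cite: BalabanImbrieJaffe1988, (5.7.5) p.289] -/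
theorem val_cubeT (ℓ : ℕ) (x : Balaban1983to89.Site P j) (μ : Fin P.d) : (cubeT ℓ x μ).val = (x μ).val / ℓ :=
  val_cubeCast ℓ (x μ)

/-- **CUBE STEPS VERSUS TORUS DISTANCE, one coordinate**: `ℓ·cdist(cube x − cube y)_μ ≤ cdist(x − y)_μ + 2ℓ`.
[cite: BalabanImbrieJaffe1988, (5.7.5) p.289] -/
theorem mul_cdist_cubeT_le {ℓ : ℕ} (hℓ : 0 < ℓ) (x y : Balaban1983to89.Site P j) (μ : Fin P.d) :
    ℓ * cdist (cubeT ℓ x μ - cubeT ℓ y μ) ≤ cdist (x μ - y μ) + 2 * ℓ := by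
  have h1 : ℓ * (cubeT ℓ x μ - cubeT ℓ y μ).val ≤ (x μ - y μ).val + 2 * ℓ := mul_val_cubeDiff_le hℓ (y μ) (x μ)
  have h2 : ℓ * (cubeT ℓ y μ - cubeT ℓ x μ).val ≤ (y μ - x μ).val + 2 * ℓ := mul_val_cubeDiff_le hℓ (x μ) (y μ)
  rw [cdist_sub_eq, cdist_sub_eq]
  rcases min_cases (x μ - y μ).val (y μ - x μ).val with ⟨h, _⟩ | ⟨h, _⟩
  · rw [h]
    exact (Nat.mul_le_mul_left ℓ (min_le_left _ _)).trans h1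
  · rw [h]
    exact (Nat.mul_le_mul_left ℓ (min_le_right _ _)).trans h2

/-- **STEPS VERSUS DISTANCE**: `ℓ·Σ_μ cdist(cube x − cube y)_μ ≤ d·(supDist x y + 2ℓ)` — a torus staircase between the cubes of two
sites has at most `d(dist/ℓ + 2)` steps. [cite: BalabanImbrieJaffe1988, (5.7.5) p.289] -/
theorem mul_l1T_cubeT_le {ℓ : ℕ} (hℓ : 0 < ℓ) (x y : Balaban1983to89.Site P j) :
    (ℓ : ℝ) * l1T (cubeT ℓ x) (cubeT ℓ y) ≤ P.d * ((supDist x y : ℝ) + 2 * ℓ) := by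
  unfold l1T
  rw [Nat.cast_sum, Finset.mul_sum]
  calc ∑ μ, (ℓ : ℝ) * ((cdist (cubeT ℓ y μ - cubeT ℓ x μ) : ℕ) : ℝ)
      ≤ ∑ _μ : Fin P.d, ((supDist x y : ℝ) + 2 * ℓ) := by
        refine Finset.sum_le_sum fun μ _ => ?_
        have h1 : ℓ * cdist (cubeT ℓ y μ - cubeT ℓ x μ) ≤ cdist (y μ - x μ) + 2 * ℓ := mul_cdist_cubeT_le hℓ y x μ
        have h2 : cdist (y μ - x μ) ≤ supDist y x := cdist_le_supDist y x μ
        rw [supDist_comm] at h2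
        have h3 : ℓ * cdist (cubeT ℓ y μ - cubeT ℓ x μ) ≤ supDist x y + 2 * ℓ := by omega
        exact_mod_cast h3
    _ = P.d * ((supDist x y : ℝ) + 2 * ℓ) := by rw [Finset.sum_const, Finset.card_univ, Fintype.card_fin, nsmul_eq_mul]

end Cubes

/-! ## §3 The association map of (5.7.5) on the torus of record -/

section Assoc

variable {P : Params} {j : ℕ} {β : Type*}

/-- **(5.7.5)**, the association on the torus `T^{(j)}`: to the site `x₀` locating `b` and the tuple `(b₁, …, b_m)` (bonds placed
on `T^{(j)}` by `pos`, `r(e_k)`-cubes of side `ℓ`) associate `X = cube(x₀) ∪ ⋃_l stairT(cube(x₀), cube(b_l))` — a connected union of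
`r(e_k)`-cubes containing them (below). [cite: BalabanImbrieJaffe1988, (5.7.5) p.289] -/
def assocT (pos : β → Balaban1983to89.Site P j) (ℓ : ℕ) (x₀ : Balaban1983to89.Site P j) (m : ℕ) (t : Fin m → β) : Finset (CubeTor P j ℓ) :=
  insert (cubeT ℓ x₀) (Finset.univ.biUnion fun l => stairT (cubeT ℓ x₀) (cubeT ℓ (pos (t l))))

/-- `X` contains the cube of `x₀`. [cite: BalabanImbrieJaffe1988, (5.7.5) p.289] -/
theorem cube_mem_assocT (pos : β → Balaban1983to89.Site P j) (ℓ : ℕ) (x₀ : Balaban1983to89.Site P j) (m : ℕ) (t : Fin m → β) :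
    cubeT ℓ x₀ ∈ assocT pos ℓ x₀ m t :=
  Finset.mem_insert_self _ _

/-- `X` contains the cubes of `b₁, …, b_m`. [cite: BalabanImbrieJaffe1988, (5.7.5) p.289] -/
theorem cube_tuple_mem_assocT (pos : β → Balaban1983to89.Site P j) (ℓ : ℕ) (x₀ : Balaban1983to89.Site P j) (m : ℕ) (t : Fin m → β) (l : Fin m) :
    cubeT ℓ (pos (t l)) ∈ assocT pos ℓ x₀ m t :=
  Finset.mem_insert_of_mem
    (Finset.mem_biUnion.mpr ⟨l, Finset.mem_univ _, right_mem_stairT (lt_of_lt_of_le Nat.zero_lt_one P.hd) _ _⟩)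

/-- `X` is never empty. [cite: BalabanImbrieJaffe1988, (5.7.5) p.289] -/
theorem assocT_ne_empty (pos : β → Balaban1983to89.Site P j) (ℓ : ℕ) (x₀ : Balaban1983to89.Site P j) (m : ℕ) (t : Fin m → β) :
    assocT pos ℓ x₀ m t ≠ ∅ :=
  Finset.ne_empty_of_mem (cube_mem_assocT pos ℓ x₀ m t)

/-- **`X` IS A CONNECTED UNION OF CUBES**: the torus touching graph (`touchT`, symmetrized) induced on `assocT pos ℓ x₀ m t` is
connected. [cite: BalabanImbrieJaffe1988, (5.7.5) p.289] -/
theorem assocT_connected (pos : β → Balaban1983to89.Site P j) (ℓ : ℕ) (x₀ : Balaban1983to89.Site P j) (m : ℕ) (t : Fin m → β) :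
    ((SimpleGraph.fromRel (touchT (dd := P.d) (n := nCube (P.sitesPerDir j) ℓ))).induce
      (↑(assocT pos ℓ x₀ m t) : Set (CubeTor P j ℓ))).Connected := by
  rw [SimpleGraph.connected_iff_exists_forall_reachable]
  have h0 : cubeT ℓ x₀ ∈ (↑(assocT pos ℓ x₀ m t) : Set (CubeTor P j ℓ)) :=
    Finset.mem_coe.mpr (cube_mem_assocT pos ℓ x₀ m t)
  refine ⟨⟨cubeT ℓ x₀, h0⟩, fun p => ?_⟩
  obtain ⟨p, hp⟩ := p
  rcases Finset.mem_insert.mp (Finset.mem_coe.mp hp) with hpb | hp'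
  · subst hpb; rfl
  · obtain ⟨l, -, hpl⟩ := Finset.mem_biUnion.mp hp'
    have hsub : stairT (cubeT ℓ x₀) (cubeT ℓ (pos (t l))) ⊆ assocT pos ℓ x₀ m t := fun q hq =>
      Finset.mem_insert_of_mem (Finset.mem_biUnion.mpr ⟨l, Finset.mem_univ _, hq⟩)
    exact reachable_of_mem_stairT _ _ _ hsub h0 hpl hp

/-- card of the association: `|X| ≤ 1 + Σ_l (Σ_μ cdist(cube(x₀) − cube(b_l))_μ + d)`. [cite: BalabanImbrieJaffe1988, (5.7.5) p.289] -/
theorem card_assocT_le (pos : β → Balaban1983to89.Site P j) (ℓ : ℕ) (x₀ : Balaban1983to89.Site P j) (m : ℕ) (t : Fin m → β) :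
    (assocT pos ℓ x₀ m t).card ≤ 1 + ∑ l, (l1T (cubeT ℓ x₀) (cubeT ℓ (pos (t l))) + P.d) := by
  unfold assocT
  refine (Finset.card_insert_le _ _).trans ?_
  rw [add_comm]
  refine Nat.add_le_add_left (Finset.card_biUnion_le.trans (Finset.sum_le_sum fun l _ => card_stairT_le _ _)) 1

/-- **TIGHTNESS OF THE TORUS ASSOCIATION**: `ℓ(|X| − 1) ≤ d·Σ_l supDist(x₀, b_l) + 3d·m·ℓ` for `X = assocT pos ℓ x₀ m (b₁,…,b_m)`
(`2d·m·ℓ` from the cube arithmetic across the seam, `d·m·ℓ` from the corners). [cite: BalabanImbrieJaffe1988, (5.7.6) p.290] -/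
theorem tight_assocT (pos : β → Balaban1983to89.Site P j) {ℓ : ℕ} (hℓ : 0 < ℓ) (x₀ : Balaban1983to89.Site P j) (m : ℕ) (t : Fin m → β) :
    (ℓ : ℝ) * (((assocT pos ℓ x₀ m t).card : ℝ) - 1) ≤
      P.d * ∑ l, (supDist x₀ (pos (t l)) : ℝ) + 3 * P.d * m * ℓ := by
  have hcard : (((assocT pos ℓ x₀ m t).card : ℕ) : ℝ) ≤
      1 + ∑ l, (((l1T (cubeT ℓ x₀) (cubeT ℓ (pos (t l))) : ℕ) : ℝ) + P.d) := by
    exact_mod_cast card_assocT_le pos ℓ x₀ m t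
  have hsum : (ℓ : ℝ) * ∑ l, (((l1T (cubeT ℓ x₀) (cubeT ℓ (pos (t l))) : ℕ) : ℝ) + P.d)
      ≤ P.d * ∑ l, (supDist x₀ (pos (t l)) : ℝ) + 3 * P.d * m * ℓ := by
    rw [Finset.mul_sum]
    calc ∑ l, (ℓ : ℝ) * ((((l1T (cubeT ℓ x₀) (cubeT ℓ (pos (t l))) : ℕ) : ℝ)) + P.d)
        ≤ ∑ l, (P.d * (supDist x₀ (pos (t l)) : ℝ) + 3 * P.d * ℓ) := by
          refine Finset.sum_le_sum fun l _ => ?_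
          have := mul_l1T_cubeT_le hℓ x₀ (pos (t l))
          nlinarith
      _ = P.d * ∑ l, (supDist x₀ (pos (t l)) : ℝ) + 3 * P.d * m * ℓ := by
          rw [Finset.sum_add_distrib, Finset.mul_sum, Finset.sum_const, Finset.card_univ, Fintype.card_fin, nsmul_eq_mul]
          ring
  have hℓ0 : (0 : ℝ) ≤ ℓ := Nat.cast_nonneg ℓ
  nlinarith

/-- tightness in the special case `x₀ = pos b` (the bond `b` itself on `T^{(j)}`, p36's convention).
[cite: BalabanImbrieJaffe1988, (5.7.6) p.290] -/
theorem tight_assocT_self (pos : β → Balaban1983to89.Site P j) {ℓ : ℕ} (hℓ : 0 < ℓ) (b : β) (m : ℕ) (t : Fin m → β) :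
    (ℓ : ℝ) * (((assocT pos ℓ (pos b) m t).card : ℝ) - 1) ≤
      P.d * ∑ l, (supDist (pos b) (pos (t l)) : ℝ) + 3 * P.d * m * ℓ :=
  tight_assocT pos hℓ (pos b) m t

end Assoc

end

end Literature.MathematicalPhysics.QuantumFieldTheory.BalabanImbrieJaffe1984to88.BIJ88Assoc575Torus
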